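import Summits.CriticalPhenomena.PercolationContinuityZ3.Theorems.Transplant.FKConnectivityAllQSPNegAssocPivotOn
import HarnessLib

/-!
# Negative association of `φ_{w,q}` REDUCED TO THE NESTED PROBE INEQUALITY (♦) — a second, pivot-free reduction

Support file (`--supports stmt-CriticalPhenomena-4575`), FK sub-lane `prim-bschramm-fk-2` (gen 10) of the post-continuity programme;
builds on p205010 (kernel theorem, internal audit signed; external expert review pending).  No named facts, no sorries, standard axioms.

WHAT IS PROVED (kernel).  Write `S₀, Z₀` / `S₁, Z₁` for the masses of `φ_{w[x↦0],q}` / `φ_{w[x↦1],q}` and `F⁰ = {ω | ω ∖ {x} ∈ F}`,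
`F¹ = {ω | ω ∪ {x} ∈ F}` for the sections of an increasing event `F` at the pair `x`.  The NESTED PROBE INEQUALITY at `x` for the pair `(F, G)`
(`G` increasing, not depending on `x`) is
  (♦)  `S₀(F⁰ ∩ G)·Z₁ + S₁(F¹ ∩ G)·Z₀ ≤ S₀(F⁰)·S₁(G) + S₁(F¹)·S₀(G)`,
i.e. `Cov₀(F⁰,G) + Cov₁(F¹,G) ≤ (φ₁(F¹) − φ₀(F⁰))·(φ₀(G) − φ₁(G))`; it is exactly the coefficient of `w_x(1 − w_x)` in the one-pair expansion
`S_w(F∩G)Z_w − S_w(F)S_w(G) = (1−w_x)²·[NA under w[x↦0]] + w_x²·[NA under w[x↦1]] + w_x(1−w_x)·[(♦)]`.  Hence (`FK.mass_negAssoc_of_nestedProbe`,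
induction on the size of the determining set of `F`, conditioning on any of its pairs): **if a class of weights closed under conditioning on pair
states satisfies (♦) for every member, every pair `x`, and all increasing `F ∋ x`-dependent, `G` `x`-independent events, then every member is negatively
associated** (`FK.negAssoc_of_nestedProbe`; on `K₄`-minor-free supports `FK.negAssoc_of_noK4Minor_of_nestedProbe`).  Compared with the Feder–Mihail
reduction (`FK.negAssoc_of_edgeNegDep_of_pivot`, gen 9) no pivot has to be CHOSEN: (♦) is demanded at every pair of the support (when `x` happens to be
a pivot of `F`, (♦) follows from negative association of the two conditioned measures, since then `φ₁(F¹) ≥ φ₀(F⁰)`).  (♦) is the 'one mixed index'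
case of the lane's Conjecture C (coefficientwise nonpositivity of `Z²Cov` in the edge odds; memo FK-Q2.md §19.4), verified in > 1.7·10⁶ exact cells on
series–parallel graphs (gen 9) and not claimed here.  [cite: Pemantle2000, Thm. 1.3, §1.5 (pp. 1379–1380)] [cite: Grimmett2006, §3.9 (pp. 63–64)]
-/

noncomputable section

namespace Summit.CriticalPhenomena.PercolationContinuityZ3.Theorems

namespace FK

open MeasureTheory Set Literature.Probability.LatticeModels Literature.Probability.Percolation
open Literature.Probability.Percolation.DecisionTree (ind ind_of_mem ind_of_not_mem ind_nonneg)
open scoped Classical symmDiff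

variable {V : Type*} [Fintype V]

/-- **Negative association from the nested probe inequality (♦), mass form.**  For a class `P` of weights closed under conditioning on pair
states, if (♦) `S₀(F⁰∩G)Z₁ + S₁(F¹∩G)Z₀ ≤ S₀(F⁰)S₁(G) + S₁(F¹)S₀(G)` holds for every member, every pair `x`, every increasing `F` and every increasing
`G` not depending on `x`, then `S_w(F ∩ G)·Z_w ≤ S_w(F)·S_w(G)` for all increasing `F`, `G` determined by disjoint finite sets of pairs.  Induction on
the size of the determining set of `F`, conditioning on any of its pairs; the cross coefficient is (♦) itself. [cite: Pemantle2000, Thm. 1.3, §1.5] -/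
theorem mass_negAssoc_of_nestedProbe {q : ℝ} (P : (Sym2 V → unitInterval) → Prop)
    (hP0 : ∀ (w : Sym2 V → unitInterval) (e : Sym2 V), P w → P (Function.update w e 0))
    (hP1 : ∀ (w : Sym2 V → unitInterval) (e : Sym2 V), P w → ((w e : unitInterval) : ℝ) ≠ 0 → P (Function.update w e 1))
    (hprobe : ∀ w : Sym2 V → unitInterval, P w → ∀ (x : Sym2 V) (F G : Set (BondConfig V)), IsUpperSet F → IsUpperSet G →
      (∀ ω : BondConfig V, ω ∆ {x} ∈ G ↔ ω ∈ G) →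
      (∑ ω : BondConfig V, rcWeightW (Function.update w x 0) q ∅ ω * ind ({ω | ω \ {x} ∈ F} ∩ G) ω) *
          rcPartitionFunctionW (Function.update w x 1) q ∅ +
        (∑ ω : BondConfig V, rcWeightW (Function.update w x 1) q ∅ ω * ind ({ω | insert x ω ∈ F} ∩ G) ω) *
          rcPartitionFunctionW (Function.update w x 0) q ∅ ≤
      (∑ ω : BondConfig V, rcWeightW (Function.update w x 0) q ∅ ω * ind {ω | ω \ {x} ∈ F} ω) *
          (∑ ω : BondConfig V, rcWeightW (Function.update w x 1) q ∅ ω * ind G ω) +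
        (∑ ω : BondConfig V, rcWeightW (Function.update w x 1) q ∅ ω * ind {ω | insert x ω ∈ F} ω) *
          (∑ ω : BondConfig V, rcWeightW (Function.update w x 0) q ∅ ω * ind G ω))
    {S : Finset (Sym2 V)} {G : Set (BondConfig V)} (hG : IsUpperSet G) (hGS : DeterminedBy G ↑S) (n : ℕ) :
    ∀ (T : Finset (Sym2 V)), T.card ≤ n → Disjoint T S → ∀ (w : Sym2 V → unitInterval), P w →
      ∀ F : Set (BondConfig V), IsUpperSet F → DeterminedBy F ↑T →
        (∑ ω : BondConfig V, rcWeightW w q ∅ ω * ind (F ∩ G) ω) * rcPartitionFunctionW w q ∅ ≤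
          (∑ ω : BondConfig V, rcWeightW w q ∅ ω * ind F ω) * (∑ ω : BondConfig V, rcWeightW w q ∅ ω * ind G ω) := by
  induction n with
  | zero =>
    intro T hT _ w _ F _ hFT
    have hT0 : T = ∅ := Finset.card_eq_zero.1 (Nat.le_zero.1 hT)
    subst hT0
    have hF0 : DeterminedBy F (∅ : Set (Sym2 V)) := by simpa using hFT
    by_cases hmem : (∅ : BondConfig V) ∈ F
    · have hFu : F = Set.univ := Set.eq_univ_of_forall fun ω => (mem_iff_empty_mem_of_determinedBy_empty hF0 ω).2 hmem
      rw [hFu, Set.univ_inter, sum_rcWeightW_ind_univ, mul_comm]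
    · have hFe : F = ∅ := Set.eq_empty_of_forall_notMem fun ω h => hmem ((mem_iff_empty_mem_of_determinedBy_empty hF0 ω).1 h)
      rw [hFe, Set.empty_inter]
      have h0 : ∑ ω : BondConfig V, rcWeightW w q ∅ ω * ind (∅ : Set (BondConfig V)) ω = 0 :=
        Finset.sum_eq_zero fun ω _ => by rw [ind_of_not_mem (Set.notMem_empty ω), mul_zero]
      rw [h0, zero_mul, zero_mul]
  | succ n ih =>
    intro T hT hTS w hw F hF hFT
    by_cases hTn : T.card ≤ n
    · exact ih T hTn hTS w hw F hF hFT
    have hTne : T.Nonempty := by rw [← Finset.card_pos]; omega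
    obtain ⟨x, hxT⟩ := hTne
    have hxS : x ∉ (↑S : Set (Sym2 V)) := fun h => Finset.disjoint_left.1 hTS hxT (by simpa using h)
    have hGx : ∀ ω : BondConfig V, ω ∆ {x} ∈ G ↔ ω ∈ G := symmDiff_singleton_mem_iff_of_determinedBy hGS hxS
    have hpr := hprobe w hw x F G hF hG hGx
    set T' := T.erase x with hT'
    have hT'c : T'.card ≤ n := by rw [hT', Finset.card_erase_of_mem hxT]; omega
    have hT'S : Disjoint T' S := Finset.disjoint_of_subset_left (Finset.erase_subset x T) hTS
    set w0 := Function.update w x 0 with hw0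
    set w1 := Function.update w x 1 with hw1
    set F0 : Set (BondConfig V) := {ω | ω \ {x} ∈ F} with hF0d
    set F1 : Set (BondConfig V) := {ω | insert x ω ∈ F} with hF1d
    set a : ℝ := ((w x : unitInterval) : ℝ) with ha
    have ha0 : 0 ≤ a := (w x).2.1
    have ha1 : a ≤ 1 := (w x).2.2
    set Z := rcPartitionFunctionW w q ∅ with hZ
    set Z0 := rcPartitionFunctionW w0 q ∅ with hZ0
    set Z1 := rcPartitionFunctionW w1 q ∅ with hZ1
    -- sections of `F` under the conditioned weights (the lane's section lemmas with the roles of the two events swapped)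
    have secFG0 : ∑ ω : BondConfig V, rcWeightW w0 q ∅ ω * ind (F ∩ G) ω = ∑ ω : BondConfig V, rcWeightW w0 q ∅ ω * ind (F0 ∩ G) ω := by
      have e1 := sum_rcWeightW_update_zero_sec w q x G F
      rw [Set.inter_comm G F, Set.inter_comm G F0] at e1; exact e1
    have secF0 : ∑ ω : BondConfig V, rcWeightW w0 q ∅ ω * ind F ω = ∑ ω : BondConfig V, rcWeightW w0 q ∅ ω * ind F0 ω := by
      have e2 := sum_rcWeightW_update_zero_sec w q x Set.univ F
      rw [Set.univ_inter, Set.univ_inter] at e2; exact e2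
    have secFG1 : ∑ ω : BondConfig V, rcWeightW w1 q ∅ ω * ind (F ∩ G) ω = ∑ ω : BondConfig V, rcWeightW w1 q ∅ ω * ind (F1 ∩ G) ω := by
      have e1 := sum_rcWeightW_update_one_sec w q x G F
      rw [Set.inter_comm G F, Set.inter_comm G F1] at e1; exact e1
    have secF1 : ∑ ω : BondConfig V, rcWeightW w1 q ∅ ω * ind F ω = ∑ ω : BondConfig V, rcWeightW w1 q ∅ ω * ind F1 ω := by
      have e2 := sum_rcWeightW_update_one_sec w q x Set.univ F
      rw [Set.univ_inter, Set.univ_inter] at e2; exact e2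
    -- the probe hypothesis with the sections replaced by `F` itself
    have cross := hpr
    rw [← secFG0, ← secFG1, ← secF0, ← secF1] at cross
    -- induction hypothesis under `w0`
    have I0 : (∑ ω : BondConfig V, rcWeightW w0 q ∅ ω * ind (F ∩ G) ω) * Z0 ≤
        (∑ ω : BondConfig V, rcWeightW w0 q ∅ ω * ind F ω) * (∑ ω : BondConfig V, rcWeightW w0 q ∅ ω * ind G ω) := by
      rw [secFG0, secF0]
      exact ih T' hT'c hT'S w0 (hP0 w x hw) F0 (isUpperSet_sec_diff hF x) (determinedBy_sec_diff hFT x)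
    by_cases hae0 : a = 0
    · have hwe : w0 = w := by
        rw [hw0]; exact Function.update_eq_self_iff.2 (Subtype.ext (by simpa [ha] using hae0.symm))
      rw [hwe] at I0; simpa [hZ0, hwe] using I0
    -- induction hypothesis under `w1`
    have I1 : (∑ ω : BondConfig V, rcWeightW w1 q ∅ ω * ind (F ∩ G) ω) * Z1 ≤
        (∑ ω : BondConfig V, rcWeightW w1 q ∅ ω * ind F ω) * (∑ ω : BondConfig V, rcWeightW w1 q ∅ ω * ind G ω) := by
      rw [secFG1, secF1]
      exact ih T' hT'c hT'S w1 (hP1 w x hw hae0) F1 (isUpperSet_sec_insert hF x) (determinedBy_sec_insert hFT x)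
    set C0 := ∑ ω : BondConfig V, rcWeightW w0 q ∅ ω * ind (F ∩ G) ω with hC0
    set C1 := ∑ ω : BondConfig V, rcWeightW w1 q ∅ ω * ind (F ∩ G) ω with hC1
    set A0 := ∑ ω : BondConfig V, rcWeightW w0 q ∅ ω * ind F ω with hA0
    set A1 := ∑ ω : BondConfig V, rcWeightW w1 q ∅ ω * ind F ω with hA1
    set M0 := ∑ ω : BondConfig V, rcWeightW w0 q ∅ ω * ind G ω with hM0
    set M1 := ∑ ω : BondConfig V, rcWeightW w1 q ∅ ω * ind G ω with hM1
    have dFG : ∑ ω : BondConfig V, rcWeightW w q ∅ ω * ind (F ∩ G) ω = (1 - a) * C0 + a * C1 :=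
      sum_rcWeightW_ind_affine w q x (F ∩ G)
    have dF : ∑ ω : BondConfig V, rcWeightW w q ∅ ω * ind F ω = (1 - a) * A0 + a * A1 := sum_rcWeightW_ind_affine w q x F
    have dG : ∑ ω : BondConfig V, rcWeightW w q ∅ ω * ind G ω = (1 - a) * M0 + a * M1 := sum_rcWeightW_ind_affine w q x G
    have dZ : Z = (1 - a) * Z0 + a * Z1 := rcPartitionFunctionW_affine w q x
    rw [dFG, dF, dG, dZ]
    have ha1' : 0 ≤ 1 - a := by linarith
    have t0 : (1 - a) ^ 2 * (C0 * Z0) ≤ (1 - a) ^ 2 * (A0 * M0) := mul_le_mul_of_nonneg_left I0 (sq_nonneg _)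
    have t1 : a ^ 2 * (C1 * Z1) ≤ a ^ 2 * (A1 * M1) := mul_le_mul_of_nonneg_left I1 (sq_nonneg _)
    have t2 : a * (1 - a) * (C0 * Z1 + C1 * Z0) ≤ a * (1 - a) * (A0 * M1 + A1 * M0) :=
      mul_le_mul_of_nonneg_left cross (mul_nonneg ha0 ha1')
    calc ((1 - a) * C0 + a * C1) * ((1 - a) * Z0 + a * Z1)
        = (1 - a) ^ 2 * (C0 * Z0) + a ^ 2 * (C1 * Z1) + a * (1 - a) * (C0 * Z1 + C1 * Z0) := by ring
      _ ≤ (1 - a) ^ 2 * (A0 * M0) + a ^ 2 * (A1 * M1) + a * (1 - a) * (A0 * M1 + A1 * M0) := by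
          linarith only [t0, t1, t2]
      _ = ((1 - a) * A0 + a * A1) * ((1 - a) * M0 + a * M1) := by ring

/-- **Negative association from the nested probe inequality (♦).**  If a class of weights closed under conditioning on pair states satisfies
(♦) `φ₀(F⁰∩G)φ₁-mass… ` — in measure form: `S₀(F⁰ ∩ G)Z₁ + S₁(F¹ ∩ G)Z₀ ≤ S₀(F⁰)S₁(G) + S₁(F¹)S₀(G)` — for every member, pair `x`, increasing `F`
and increasing `G` not depending on `x`, then `φ_{w,q}(F ∩ G) ≤ φ_{w,q}(F)·φ_{w,q}(G)` for all increasing `F`, `G` determined by disjoint finite sets of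
pairs and every member `w`.  No pivot is chosen (contrast `FK.negAssoc_of_edgeNegDep_of_pivot`). [cite: Pemantle2000, Thm. 1.3, §1.5 (pp. 1379–1380)] -/
theorem negAssoc_of_nestedProbe {q : ℝ} (hq : 0 < q) (P : (Sym2 V → unitInterval) → Prop)
    (hP0 : ∀ (w : Sym2 V → unitInterval) (e : Sym2 V), P w → P (Function.update w e 0))
    (hP1 : ∀ (w : Sym2 V → unitInterval) (e : Sym2 V), P w → ((w e : unitInterval) : ℝ) ≠ 0 → P (Function.update w e 1))
    (hprobe : ∀ w : Sym2 V → unitInterval, P w → ∀ (x : Sym2 V) (F G : Set (BondConfig V)), IsUpperSet F → IsUpperSet G →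
      (∀ ω : BondConfig V, ω ∆ {x} ∈ G ↔ ω ∈ G) →
      (∑ ω : BondConfig V, rcWeightW (Function.update w x 0) q ∅ ω * ind ({ω | ω \ {x} ∈ F} ∩ G) ω) *
          rcPartitionFunctionW (Function.update w x 1) q ∅ +
        (∑ ω : BondConfig V, rcWeightW (Function.update w x 1) q ∅ ω * ind ({ω | insert x ω ∈ F} ∩ G) ω) *
          rcPartitionFunctionW (Function.update w x 0) q ∅ ≤
      (∑ ω : BondConfig V, rcWeightW (Function.update w x 0) q ∅ ω * ind {ω | ω \ {x} ∈ F} ω) *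
          (∑ ω : BondConfig V, rcWeightW (Function.update w x 1) q ∅ ω * ind G ω) +
        (∑ ω : BondConfig V, rcWeightW (Function.update w x 1) q ∅ ω * ind {ω | insert x ω ∈ F} ω) *
          (∑ ω : BondConfig V, rcWeightW (Function.update w x 0) q ∅ ω * ind G ω))
    {w : Sym2 V → unitInterval} (hw : P w) {S T : Finset (Sym2 V)} (hST : Disjoint S T) {F G : Set (BondConfig V)}
    (hF : IsUpperSet F) (hG : IsUpperSet G) (hFT : DeterminedBy F ↑T) (hGS : DeterminedBy G ↑S) :
    (rcMeasureW w q ∅).real (F ∩ G) ≤ (rcMeasureW w q ∅).real F * (rcMeasureW w q ∅).real G :=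
  real_le_real_mul_real_of_mass hq
    (mass_negAssoc_of_nestedProbe P hP0 hP1 hprobe hG hGS T.card T le_rfl hST.symm w hw F hF hFT)

/-- **On `K₄`-minor-free supports: negative association of `φ_{w,q}`, `0 < q < 1`, REDUCED TO THE NESTED PROBE INEQUALITY (♦).**  If (♦) holds for
every weight vector supported in the edge set of the `K₄`-minor-free graph `𝒢`, then every such `φ_{w,q}` is negatively associated.  ((♦) is the
one-mixed-index case of the lane's 'coefficientwise' Conjecture C, numerically clean on series–parallel graphs; NOT claimed.)
[cite: Grimmett2006, §3.9 (pp. 63–64)] [cite: Pemantle2000, Conj. 2] -/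
theorem negAssoc_of_noK4Minor_of_nestedProbe {q : ℝ} (hq0 : 0 < q) (𝒢 : SimpleGraph V)
    (hprobe : ∀ w : Sym2 V → unitInterval, (∀ e, ((w e : unitInterval) : ℝ) ≠ 0 → e ∈ 𝒢.edgeSet) →
      ∀ (x : Sym2 V) (F G : Set (BondConfig V)), IsUpperSet F → IsUpperSet G → (∀ ω : BondConfig V, ω ∆ {x} ∈ G ↔ ω ∈ G) →
      (∑ ω : BondConfig V, rcWeightW (Function.update w x 0) q ∅ ω * ind ({ω | ω \ {x} ∈ F} ∩ G) ω) *
          rcPartitionFunctionW (Function.update w x 1) q ∅ +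
        (∑ ω : BondConfig V, rcWeightW (Function.update w x 1) q ∅ ω * ind ({ω | insert x ω ∈ F} ∩ G) ω) *
          rcPartitionFunctionW (Function.update w x 0) q ∅ ≤
      (∑ ω : BondConfig V, rcWeightW (Function.update w x 0) q ∅ ω * ind {ω | ω \ {x} ∈ F} ω) *
          (∑ ω : BondConfig V, rcWeightW (Function.update w x 1) q ∅ ω * ind G ω) +
        (∑ ω : BondConfig V, rcWeightW (Function.update w x 1) q ∅ ω * ind {ω | insert x ω ∈ F} ω) *
          (∑ ω : BondConfig V, rcWeightW (Function.update w x 0) q ∅ ω * ind G ω))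
    (w : Sym2 V → unitInterval) (hw : ∀ e, ((w e : unitInterval) : ℝ) ≠ 0 → e ∈ 𝒢.edgeSet)
    {S T : Finset (Sym2 V)} (hST : Disjoint S T) {F G : Set (BondConfig V)} (hF : IsUpperSet F) (hG : IsUpperSet G)
    (hFT : DeterminedBy F ↑T) (hGS : DeterminedBy G ↑S) :
    (rcMeasureW w q ∅).real (F ∩ G) ≤ (rcMeasureW w q ∅).real F * (rcMeasureW w q ∅).real G :=
  negAssoc_of_nestedProbe hq0 (fun w => ∀ e, ((w e : unitInterval) : ℝ) ≠ 0 → e ∈ 𝒢.edgeSet)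
    (fun w e hw => support_update_zero_subset w hw e) (fun w _ hw he => support_update_one_subset w hw he) hprobe hw hST hF hG hFT hGS

end FK

end Summit.CriticalPhenomena.PercolationContinuityZ3.Theorems

end
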